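import Summits.Parity.GeneralizedHardyLittlewood.Theorems.PrimeLevelFamEdgeMomentsBeyondDiagonalDiagRemTwoTwoMonomials
import HarnessLib

/-!
# Route `PrimeLevelFamEdge`, crux K_A `MomentsBeyondDiagonal` (stmt-Parity-20007), line «petersson_layers» v4, stub `stub_diag`:
# **the monomial bookkeeping of the order-`(1,3)` remainder weight** (brick B3 of the remainder estimate (R₁₃), abstract form)

Brick B3 of the order-`(1,3)` remainder estimate (R₁₃) — the hypothesis `hR` of
`…DiagDecorOrderOneThreeTarget.orderOneThree_target_of_remainder` (p831701). For fixed Selberg coordinates `(c,g)` the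
Hecke-summed remainder weight of order `(1,3)` (`…DiagDecorOrderRungThreeHecke.heckeSum_orderOneThree_eq`, p831428) is

  `Wt₁₃ = (L⁴ − 3S₂² + 2S₄)/16·r₀₀ + (3L³ − 3LS₂)/8·r₀₁ + (3L² − 3S₂)/4·r₀₂ + L/2·r₀₃ + (L³ + 3LS₂)/8·r₁₀ + (3L² + 3S₂)/4·r₁₁
         + 3L/2·r₁₂ + r₁₃`,

`L = 2β + ℓ⁺(k₁) + ℓ⁺(k₂)`, `S₂ = P2(k₁) + P2(k₂)`, `S₄ = P4(k₁) + P4(k₂)`, remainders at `y = αk₁k₂`. This is the order-`(1,3)`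
twin of `…DiagRemTwoTwoMonomials` (p831214), with ABSTRACT remainders `R_ab : ℝ → ℝ` and decorations `P2, P4 : ℕ → ℝ`: by the
generic `L`-power lemma `…DiagRemTwoTwoLpow.abs_Lpow_monomial_le` the weight is `19` terms — undecorated ones (prefactor
`(2Λ+1)⁴ ≤ 81Λ⁴`, envelope `Ψ₀`), one-sided `P2`-decorated ones (`6Λ + 3 ≤ 11Λ²`, envelope `Ψ₂`; rows moved to columns by
`k₁ ↔ k₂`), one-sided `3P2² − 2P4`-decorated ones (`1/8`, envelope `Ψ₄`; note `−3S₂² + 2S₄ = −(3P2₁²−2P4₁) − (3P2₂²−2P4₂) − 6P2₁P2₂`)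
and the both-sided `P2 ⊗ P2 · r₀₀` monomial (`3/8`, envelope `Ψ_B`). The homogeneous weight is `4` as for order `(2,2)`, so the
bound is stated with the SAME envelope combination `81Λ⁴Ψ₀ + 11Λ²Ψ₂ + Ψ₄ + Ψ_B` (and the inner estimate of (R₁₃) can reuse
`…DiagRemTwoTwoEnvelopes.envelope_arith₂₂` verbatim).

* `abs_monomial_weight_le₁₃` — one profile monomial against `Wt₁₃`: `≤ (81Λ⁴Ψ₀ + 11Λ²Ψ₂ + Ψ₄ + Ψ_B)·log^{m₁+m₂}Y`;
* `abs_profile_weight_le₁₃` — **the profile-weighted sum against `Wt₁₃`: `≤ (Σ|Pᵢ|)²·(81Λ⁴Ψ₀ + 11Λ²Ψ₂ + Ψ₄ + Ψ_B)`.**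

Def-free; theorems only. Helper `--supports stmt-Parity-20007`; closes nothing; K_A, K_B and the Parity summit are NOT
proved; nothing about Landau–Siegel zeros.

## References
* E. Kowalski, P. Michel, J. VanderKam, J. reine angew. Math. 526 (2000), (22)–(28) pp. 12–15 and Prop. 5.1 p. 18.
  [cite: KowalskiMichelVanderKam2000, (23)–(28) — derivation (order-(1,3) remainder weight, monomial bookkeeping)]
-/

noncomputable section

open Finset Real Polynomial

namespace Summit.Parity.GeneralizedHardyLittlewood.Theorems.MomentsBeyondDiagonal.DiagCorner

open Summit.Parity.GeneralizedHardyLittlewood.Theorems.BeyondDiagonalBeatsQuarter.Corner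

set_option maxHeartbeats 1600000 in
-- 19 monomial bounds combined by `linarith`
/-- **One monomial `ℓ⁺(k₁)^{m₁}ℓ⁺(k₂)^{m₂}` (`m₁, m₂ ≥ 1`) against the order-`(1,3)` remainder weight `Wt₁₃`** (module
docstring; `L = 2β + ℓ⁺₁ + ℓ⁺₂`, `S₂ = P2(k₁)+P2(k₂)`, `S₄ = P4(k₁)+P4(k₂)`, remainders at `αk₁k₂`). If the undecorated
monomial sums (eight remainders) are `≤ logⁱ⁺ʲY·Ψ₀`, the column-`P2`-decorated ones (remainders `r₀₁,r₁₀,r₀₂,r₁₁`)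
`≤ logⁱ⁺ʲY·Ψ₂`, the column-`(3P2²−2P4)`-decorated `r₀₀`-sum `≤ logⁱ⁺ʲY·Ψ₄` and the both-sided `P2⊗P2·r₀₀`-sum `≤ logⁱ⁺ʲY·Ψ_B`
(all `i, j ≥ 1`), then the sum is `≤ (81Λ⁴Ψ₀ + 11Λ²Ψ₂ + Ψ₄ + Ψ_B)·log^{m₁+m₂}Y`.
[cite: KowalskiMichelVanderKam2000, (23)–(28) — derivation (order-(1,3) remainder weight, one monomial)] -/
theorem abs_monomial_weight_le₁₃ {a P2 P4 : ℕ → ℝ} {R₀₀ R₀₁ R₁₀ R₀₂ R₁₁ R₁₂ R₀₃ R₁₃ : ℝ → ℝ}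
    {Y α β Λ Ψ₀ Ψ₂ Ψ₄ ΨB : ℝ} {m₁ m₂ : ℕ}
    (hm₁ : 1 ≤ m₁) (hm₂ : 1 ≤ m₂) (hY : 1 ≤ Y) (hΛ : 1 ≤ Λ) (hβ : |β| ≤ Λ) (hLY : Real.log Y ≤ Λ)
    (hΨ₀ : 0 ≤ Ψ₀) (hΨ₂ : 0 ≤ Ψ₂) (hΨ₄ : 0 ≤ Ψ₄) (hΨB : 0 ≤ ΨB)
    (h0 : ∀ R : ℝ → ℝ, (R = R₀₀ ∨ R = R₀₁ ∨ R = R₁₀ ∨ R = R₀₂ ∨ R = R₁₁ ∨ R = R₁₂ ∨ R = R₀₃ ∨ R = R₁₃) →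
      ∀ i j : ℕ, 1 ≤ i → 1 ≤ j →
      |∑ k₁ ∈ Icc 1 ⌊Y⌋₊, ∑ k₂ ∈ Icc 1 ⌊Y⌋₊,
          a k₁ * a k₂ * ellp Y k₁ ^ i * ellp Y k₂ ^ j * R (α * k₁ * k₂)| ≤ Real.log Y ^ (i + j) * Ψ₀)
    (h2 : ∀ R : ℝ → ℝ, (R = R₀₁ ∨ R = R₁₀ ∨ R = R₀₂ ∨ R = R₁₁) →
      ∀ i j : ℕ, 1 ≤ i → 1 ≤ j →
      |∑ k₁ ∈ Icc 1 ⌊Y⌋₊, ∑ k₂ ∈ Icc 1 ⌊Y⌋₊,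
          a k₁ * (a k₂ * P2 k₂) * ellp Y k₁ ^ i * ellp Y k₂ ^ j * R (α * k₁ * k₂)| ≤ Real.log Y ^ (i + j) * Ψ₂)
    (h4 : ∀ i j : ℕ, 1 ≤ i → 1 ≤ j →
      |∑ k₁ ∈ Icc 1 ⌊Y⌋₊, ∑ k₂ ∈ Icc 1 ⌊Y⌋₊,
          a k₁ * (a k₂ * (3 * P2 k₂ ^ 2 - 2 * P4 k₂)) * ellp Y k₁ ^ i * ellp Y k₂ ^ j * R₀₀ (α * k₁ * k₂)| ≤
        Real.log Y ^ (i + j) * Ψ₄)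
    (hB : ∀ i j : ℕ, 1 ≤ i → 1 ≤ j →
      |∑ k₁ ∈ Icc 1 ⌊Y⌋₊, ∑ k₂ ∈ Icc 1 ⌊Y⌋₊,
          (a k₁ * P2 k₁) * (a k₂ * P2 k₂) * ellp Y k₁ ^ i * ellp Y k₂ ^ j * R₀₀ (α * k₁ * k₂)| ≤
        Real.log Y ^ (i + j) * ΨB) :
    |∑ k₁ ∈ Icc 1 ⌊Y⌋₊, ∑ k₂ ∈ Icc 1 ⌊Y⌋₊,
        a k₁ * a k₂ * ellp Y k₁ ^ m₁ * ellp Y k₂ ^ m₂ *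
          ((((2 * β + ellp Y k₁ + ellp Y k₂) ^ 4 - 3 * (P2 k₁ + P2 k₂) ^ 2 + 2 * (P4 k₁ + P4 k₂)) / 16 * R₀₀ (α * k₁ * k₂) +
            (3 * (2 * β + ellp Y k₁ + ellp Y k₂) ^ 3 - 3 * (2 * β + ellp Y k₁ + ellp Y k₂) * (P2 k₁ + P2 k₂)) / 8 * R₀₁ (α * k₁ * k₂) +
            (3 * (2 * β + ellp Y k₁ + ellp Y k₂) ^ 2 - 3 * (P2 k₁ + P2 k₂)) / 4 * R₀₂ (α * k₁ * k₂) +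
            (2 * β + ellp Y k₁ + ellp Y k₂) / 2 * R₀₃ (α * k₁ * k₂) +
            ((2 * β + ellp Y k₁ + ellp Y k₂) ^ 3 + 3 * (2 * β + ellp Y k₁ + ellp Y k₂) * (P2 k₁ + P2 k₂)) / 8 * R₁₀ (α * k₁ * k₂) +
            (3 * (2 * β + ellp Y k₁ + ellp Y k₂) ^ 2 + 3 * (P2 k₁ + P2 k₂)) / 4 * R₁₁ (α * k₁ * k₂) +
            3 * (2 * β + ellp Y k₁ + ellp Y k₂) / 2 * R₁₂ (α * k₁ * k₂) +
            R₁₃ (α * k₁ * k₂)))| ≤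
      (81 * Λ ^ 4 * Ψ₀ + 11 * Λ ^ 2 * Ψ₂ + Ψ₄ + ΨB) * Real.log Y ^ (m₁ + m₂) := by
  have hL0 : 0 ≤ Real.log Y := Real.log_nonneg hY
  have hΛ0 : 0 ≤ Λ := zero_le_one.trans hΛ
  set I := Icc 1 ⌊Y⌋₊ with hI
  set X₀ : ℝ := Real.log Y ^ (m₁ + m₂) * Ψ₀ with hX₀
  set X₂ : ℝ := Real.log Y ^ (m₁ + m₂) * Ψ₂ with hX₂
  set X₄ : ℝ := Real.log Y ^ (m₁ + m₂) * Ψ₄ with hX₄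
  set XB : ℝ := Real.log Y ^ (m₁ + m₂) * ΨB with hXB
  have hX₀0 : 0 ≤ X₀ := by positivity
  have hX₂0 : 0 ≤ X₂ := by positivity
  have hX₄0 : 0 ≤ X₄ := by positivity
  have hXB0 : 0 ≤ XB := by positivity
  -- the generic `L`-power bounds, per remainder and decoration
  have G00 := abs_Lpow_monomial_le hY hΛ hβ hLY hΨ₀ (h0 R₀₀ (Or.inl rfl))
  have G01 := abs_Lpow_monomial_le hY hΛ hβ hLY hΨ₀ (h0 R₀₁ (Or.inr (Or.inl rfl)))
  have G10 := abs_Lpow_monomial_le hY hΛ hβ hLY hΨ₀ (h0 R₁₀ (Or.inr (Or.inr (Or.inl rfl))))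
  have G02 := abs_Lpow_monomial_le hY hΛ hβ hLY hΨ₀ (h0 R₀₂ (Or.inr (Or.inr (Or.inr (Or.inl rfl)))))
  have G11 := abs_Lpow_monomial_le hY hΛ hβ hLY hΨ₀ (h0 R₁₁ (Or.inr (Or.inr (Or.inr (Or.inr (Or.inl rfl))))))
  have G12 := abs_Lpow_monomial_le hY hΛ hβ hLY hΨ₀ (h0 R₁₂ (Or.inr (Or.inr (Or.inr (Or.inr (Or.inr (Or.inl rfl)))))))
  have G03 := abs_Lpow_monomial_le hY hΛ hβ hLY hΨ₀ (h0 R₀₃ (Or.inr (Or.inr (Or.inr (Or.inr (Or.inr (Or.inr (Or.inl rfl))))))))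
  have G13 := abs_Lpow_monomial_le hY hΛ hβ hLY hΨ₀ (h0 R₁₃ (Or.inr (Or.inr (Or.inr (Or.inr (Or.inr (Or.inr (Or.inr rfl))))))))
  have P01 := abs_Lpow_monomial_le hY hΛ hβ hLY hΨ₂ (h2 R₀₁ (Or.inl rfl))
  have P10 := abs_Lpow_monomial_le hY hΛ hβ hLY hΨ₂ (h2 R₁₀ (Or.inr (Or.inl rfl)))
  have P02 := abs_Lpow_monomial_le hY hΛ hβ hLY hΨ₂ (h2 R₀₂ (Or.inr (Or.inr (Or.inl rfl))))
  have P11 := abs_Lpow_monomial_le hY hΛ hβ hLY hΨ₂ (h2 R₁₁ (Or.inr (Or.inr (Or.inr rfl))))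
  have D00 := abs_Lpow_monomial_le hY hΛ hβ hLY hΨ₄ h4
  have B00 := abs_Lpow_monomial_le hY hΛ hβ hLY hΨB hB
  -- the 19 term bounds
  have g1 := G00 4 m₁ m₂ hm₁ hm₂
  have g2 := D00 0 m₁ m₂ hm₁ hm₂
  have g3 := D00 0 m₂ m₁ hm₂ hm₁
  have g4 := B00 0 m₁ m₂ hm₁ hm₂
  have g5 := G01 3 m₁ m₂ hm₁ hm₂
  have g6 := P01 1 m₁ m₂ hm₁ hm₂
  have g7 := P01 1 m₂ m₁ hm₂ hm₁
  have g8 := G02 2 m₁ m₂ hm₁ hm₂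
  have g9 := P02 0 m₁ m₂ hm₁ hm₂
  have g10 := P02 0 m₂ m₁ hm₂ hm₁
  have g11 := G03 1 m₁ m₂ hm₁ hm₂
  have g12 := G10 3 m₁ m₂ hm₁ hm₂
  have g13 := P10 1 m₁ m₂ hm₁ hm₂
  have g14 := P10 1 m₂ m₁ hm₂ hm₁
  have g15 := G11 2 m₁ m₂ hm₁ hm₂
  have g16 := P11 0 m₁ m₂ hm₁ hm₂
  have g17 := P11 0 m₂ m₁ hm₂ hm₁
  have g18 := G12 1 m₁ m₂ hm₁ hm₂
  have g19 := G13 0 m₁ m₂ hm₁ hm₂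
  rw [show m₂ + m₁ = m₁ + m₂ from add_comm _ _] at g3 g7 g10 g14 g17
  rw [← hI] at g1 g2 g3 g4 g5 g6 g7 g8 g9 g10 g11 g12 g13 g14 g15 g16 g17 g18 g19
  simp only [← hX₀, ← hX₂, ← hX₄, ← hXB] at g1 g2 g3 g4 g5 g6 g7 g8 g9 g10 g11 g12 g13 g14 g15 g16 g17 g18 g19
  -- the decomposition of the weight into the 19 terms
  have hid : ∑ k₁ ∈ I, ∑ k₂ ∈ I,
      a k₁ * a k₂ * ellp Y k₁ ^ m₁ * ellp Y k₂ ^ m₂ *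
        ((((2 * β + ellp Y k₁ + ellp Y k₂) ^ 4 - 3 * (P2 k₁ + P2 k₂) ^ 2 + 2 * (P4 k₁ + P4 k₂)) / 16 * R₀₀ (α * k₁ * k₂) +
            (3 * (2 * β + ellp Y k₁ + ellp Y k₂) ^ 3 - 3 * (2 * β + ellp Y k₁ + ellp Y k₂) * (P2 k₁ + P2 k₂)) / 8 * R₀₁ (α * k₁ * k₂) +
            (3 * (2 * β + ellp Y k₁ + ellp Y k₂) ^ 2 - 3 * (P2 k₁ + P2 k₂)) / 4 * R₀₂ (α * k₁ * k₂) +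
            (2 * β + ellp Y k₁ + ellp Y k₂) / 2 * R₀₃ (α * k₁ * k₂) +
            ((2 * β + ellp Y k₁ + ellp Y k₂) ^ 3 + 3 * (2 * β + ellp Y k₁ + ellp Y k₂) * (P2 k₁ + P2 k₂)) / 8 * R₁₀ (α * k₁ * k₂) +
            (3 * (2 * β + ellp Y k₁ + ellp Y k₂) ^ 2 + 3 * (P2 k₁ + P2 k₂)) / 4 * R₁₁ (α * k₁ * k₂) +
            3 * (2 * β + ellp Y k₁ + ellp Y k₂) / 2 * R₁₂ (α * k₁ * k₂) +
            R₁₃ (α * k₁ * k₂))) =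
      1 / 16 * ∑ k₁ ∈ I, ∑ k₂ ∈ I, a k₁ * a k₂ * ellp Y k₁ ^ m₁ * ellp Y k₂ ^ m₂ *
        ((2 * β + ellp Y k₁ + ellp Y k₂) ^ 4 * R₀₀ (α * k₁ * k₂)) -
      1 / 16 * ∑ k₁ ∈ I, ∑ k₂ ∈ I, a k₁ * (a k₂ * (3 * P2 k₂ ^ 2 - 2 * P4 k₂)) * ellp Y k₁ ^ m₁ * ellp Y k₂ ^ m₂ *
        ((2 * β + ellp Y k₁ + ellp Y k₂) ^ 0 * R₀₀ (α * k₁ * k₂)) -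
      1 / 16 * ∑ k₁ ∈ I, ∑ k₂ ∈ I, a k₁ * (3 * P2 k₁ ^ 2 - 2 * P4 k₁) * a k₂ * ellp Y k₁ ^ m₁ * ellp Y k₂ ^ m₂ *
        ((2 * β + ellp Y k₁ + ellp Y k₂) ^ 0 * R₀₀ (α * k₁ * k₂)) -
      3 / 8 * ∑ k₁ ∈ I, ∑ k₂ ∈ I, (a k₁ * P2 k₁) * (a k₂ * P2 k₂) * ellp Y k₁ ^ m₁ * ellp Y k₂ ^ m₂ *
        ((2 * β + ellp Y k₁ + ellp Y k₂) ^ 0 * R₀₀ (α * k₁ * k₂)) +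
      3 / 8 * ∑ k₁ ∈ I, ∑ k₂ ∈ I, a k₁ * a k₂ * ellp Y k₁ ^ m₁ * ellp Y k₂ ^ m₂ *
        ((2 * β + ellp Y k₁ + ellp Y k₂) ^ 3 * R₀₁ (α * k₁ * k₂)) -
      3 / 8 * ∑ k₁ ∈ I, ∑ k₂ ∈ I, a k₁ * (a k₂ * P2 k₂) * ellp Y k₁ ^ m₁ * ellp Y k₂ ^ m₂ *
        ((2 * β + ellp Y k₁ + ellp Y k₂) ^ 1 * R₀₁ (α * k₁ * k₂)) -
      3 / 8 * ∑ k₁ ∈ I, ∑ k₂ ∈ I, a k₁ * P2 k₁ * a k₂ * ellp Y k₁ ^ m₁ * ellp Y k₂ ^ m₂ *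
        ((2 * β + ellp Y k₁ + ellp Y k₂) ^ 1 * R₀₁ (α * k₁ * k₂)) +
      3 / 4 * ∑ k₁ ∈ I, ∑ k₂ ∈ I, a k₁ * a k₂ * ellp Y k₁ ^ m₁ * ellp Y k₂ ^ m₂ *
        ((2 * β + ellp Y k₁ + ellp Y k₂) ^ 2 * R₀₂ (α * k₁ * k₂)) -
      3 / 4 * ∑ k₁ ∈ I, ∑ k₂ ∈ I, a k₁ * (a k₂ * P2 k₂) * ellp Y k₁ ^ m₁ * ellp Y k₂ ^ m₂ *
        ((2 * β + ellp Y k₁ + ellp Y k₂) ^ 0 * R₀₂ (α * k₁ * k₂)) -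
      3 / 4 * ∑ k₁ ∈ I, ∑ k₂ ∈ I, a k₁ * P2 k₁ * a k₂ * ellp Y k₁ ^ m₁ * ellp Y k₂ ^ m₂ *
        ((2 * β + ellp Y k₁ + ellp Y k₂) ^ 0 * R₀₂ (α * k₁ * k₂)) +
      1 / 2 * ∑ k₁ ∈ I, ∑ k₂ ∈ I, a k₁ * a k₂ * ellp Y k₁ ^ m₁ * ellp Y k₂ ^ m₂ *
        ((2 * β + ellp Y k₁ + ellp Y k₂) ^ 1 * R₀₃ (α * k₁ * k₂)) +
      1 / 8 * ∑ k₁ ∈ I, ∑ k₂ ∈ I, a k₁ * a k₂ * ellp Y k₁ ^ m₁ * ellp Y k₂ ^ m₂ *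
        ((2 * β + ellp Y k₁ + ellp Y k₂) ^ 3 * R₁₀ (α * k₁ * k₂)) +
      3 / 8 * ∑ k₁ ∈ I, ∑ k₂ ∈ I, a k₁ * (a k₂ * P2 k₂) * ellp Y k₁ ^ m₁ * ellp Y k₂ ^ m₂ *
        ((2 * β + ellp Y k₁ + ellp Y k₂) ^ 1 * R₁₀ (α * k₁ * k₂)) +
      3 / 8 * ∑ k₁ ∈ I, ∑ k₂ ∈ I, a k₁ * P2 k₁ * a k₂ * ellp Y k₁ ^ m₁ * ellp Y k₂ ^ m₂ *
        ((2 * β + ellp Y k₁ + ellp Y k₂) ^ 1 * R₁₀ (α * k₁ * k₂)) +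
      3 / 4 * ∑ k₁ ∈ I, ∑ k₂ ∈ I, a k₁ * a k₂ * ellp Y k₁ ^ m₁ * ellp Y k₂ ^ m₂ *
        ((2 * β + ellp Y k₁ + ellp Y k₂) ^ 2 * R₁₁ (α * k₁ * k₂)) +
      3 / 4 * ∑ k₁ ∈ I, ∑ k₂ ∈ I, a k₁ * (a k₂ * P2 k₂) * ellp Y k₁ ^ m₁ * ellp Y k₂ ^ m₂ *
        ((2 * β + ellp Y k₁ + ellp Y k₂) ^ 0 * R₁₁ (α * k₁ * k₂)) +
      3 / 4 * ∑ k₁ ∈ I, ∑ k₂ ∈ I, a k₁ * P2 k₁ * a k₂ * ellp Y k₁ ^ m₁ * ellp Y k₂ ^ m₂ *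
        ((2 * β + ellp Y k₁ + ellp Y k₂) ^ 0 * R₁₁ (α * k₁ * k₂)) +
      3 / 2 * ∑ k₁ ∈ I, ∑ k₂ ∈ I, a k₁ * a k₂ * ellp Y k₁ ^ m₁ * ellp Y k₂ ^ m₂ *
        ((2 * β + ellp Y k₁ + ellp Y k₂) ^ 1 * R₁₂ (α * k₁ * k₂)) +
      1 * ∑ k₁ ∈ I, ∑ k₂ ∈ I, a k₁ * a k₂ * ellp Y k₁ ^ m₁ * ellp Y k₂ ^ m₂ *
        ((2 * β + ellp Y k₁ + ellp Y k₂) ^ 0 * R₁₃ (α * k₁ * k₂)) := by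
    simp only [Finset.mul_sum, ← Finset.sum_add_distrib, ← Finset.sum_sub_distrib]
    refine Finset.sum_congr rfl fun k₁ _ ↦ Finset.sum_congr rfl fun k₂ _ ↦ ?_
    ring
  rw [hid]
  -- move the row decorations to the column
  have hsw4 : ∑ k₁ ∈ I, ∑ k₂ ∈ I, a k₁ * (3 * P2 k₁ ^ 2 - 2 * P4 k₁) * a k₂ * ellp Y k₁ ^ m₁ * ellp Y k₂ ^ m₂ *
        ((2 * β + ellp Y k₁ + ellp Y k₂) ^ 0 * R₀₀ (α * k₁ * k₂)) =
      ∑ k₁ ∈ I, ∑ k₂ ∈ I, a k₁ * (a k₂ * (3 * P2 k₂ ^ 2 - 2 * P4 k₂)) * ellp Y k₁ ^ m₂ * ellp Y k₂ ^ m₁ *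
        ((2 * β + ellp Y k₁ + ellp Y k₂) ^ 0 * R₀₀ (α * k₁ * k₂)) :=
    sum_swap_decor_Lpow a (fun k ↦ 3 * P2 k ^ 2 - 2 * P4 k) R₀₀ Y α β m₁ m₂ 0 I
  rw [hsw4, sum_swap_decor_Lpow a P2 R₀₁ Y α β m₁ m₂ 1 I, sum_swap_decor_Lpow a P2 R₀₂ Y α β m₁ m₂ 0 I,
    sum_swap_decor_Lpow a P2 R₁₀ Y α β m₁ m₂ 1 I, sum_swap_decor_Lpow a P2 R₁₁ Y α β m₁ m₂ 0 I]
  -- numerics of the prefactors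
  have hΛ1 : Λ ≤ Λ ^ 4 := le_self_pow₀ hΛ (by norm_num)
  have hΛ2 : Λ ^ 2 ≤ Λ ^ 4 := pow_le_pow_right₀ hΛ (by norm_num)
  have hΛ3 : Λ ^ 3 ≤ Λ ^ 4 := pow_le_pow_right₀ hΛ (by norm_num)
  have hΛ4 : 1 ≤ Λ ^ 4 := one_le_pow₀ hΛ
  have hΛ12 : Λ ≤ Λ ^ 2 := le_self_pow₀ hΛ (by norm_num)
  have hΛ02 : 1 ≤ Λ ^ 2 := one_le_pow₀ hΛ
  have e4 : (4 * Λ) ^ 4 = 256 * Λ ^ 4 := by ring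
  have e3 : (4 * Λ) ^ 3 = 64 * Λ ^ 3 := by ring
  have e2 : (4 * Λ) ^ 2 = 16 * Λ ^ 2 := by ring
  have e1 : (4 * Λ) ^ 1 = 4 * Λ := by ring
  have e0 : (4 * Λ) ^ 0 = 1 := by ring
  rw [e4] at g1
  rw [e3] at g5 g12
  rw [e2] at g8 g15
  rw [e1] at g6 g7 g11 g13 g14 g18
  rw [e0] at g2 g3 g4 g9 g10 g16 g17 g19
  have k1 : Λ ^ 3 * X₀ ≤ Λ ^ 4 * X₀ := mul_le_mul_of_nonneg_right hΛ3 hX₀0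
  have k2 : Λ ^ 2 * X₀ ≤ Λ ^ 4 * X₀ := mul_le_mul_of_nonneg_right hΛ2 hX₀0
  have k3 : Λ * X₀ ≤ Λ ^ 4 * X₀ := mul_le_mul_of_nonneg_right hΛ1 hX₀0
  have k4 : 1 * X₀ ≤ Λ ^ 4 * X₀ := mul_le_mul_of_nonneg_right hΛ4 hX₀0
  have k5 : Λ * X₂ ≤ Λ ^ 2 * X₂ := mul_le_mul_of_nonneg_right hΛ12 hX₂0
  have k6 : 1 * X₂ ≤ Λ ^ 2 * X₂ := mul_le_mul_of_nonneg_right hΛ02 hX₂0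
  have htot : (81 * Λ ^ 4 * Ψ₀ + 11 * Λ ^ 2 * Ψ₂ + Ψ₄ + ΨB) * Real.log Y ^ (m₁ + m₂) =
      81 * (Λ ^ 4 * X₀) + 11 * (Λ ^ 2 * X₂) + X₄ + XB := by
    rw [hX₀, hX₂, hX₄, hXB]; ring
  rw [htot]
  rw [abs_le] at g1 g2 g3 g4 g5 g6 g7 g8 g9 g10 g11 g12 g13 g14 g15 g16 g17 g18 g19 ⊢
  constructor <;> linarith [g1.1, g1.2, g2.1, g2.2, g3.1, g3.2, g4.1, g4.2, g5.1, g5.2, g6.1, g6.2, g7.1, g7.2, g8.1, g8.2, g9.1, g9.2, g10.1, g10.2, g11.1, g11.2, g12.1, g12.2, g13.1, g13.2, g14.1, g14.2, g15.1, g15.2, g16.1, g16.2, g17.1, g17.2, g18.1, g18.2, g19.1, g19.2, k1, k2, k3, k4, k5, k6, hX₀0, hX₂0, hX₄0, hXB0]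

set_option maxHeartbeats 800000 in
-- large statement
/-- **The profile-weighted sum against the order-`(1,3)` remainder weight**: under the hypotheses of
`abs_monomial_weight_le₁₃`, for a real polynomial `P` with `P₀ = 0`, `0 < L`, `log Y ≤ L`:
`|Σ a(k₁)P(ℓ⁺₁/L)·a(k₂)P(ℓ⁺₂/L)·Wt₁₃(k₁,k₂)| ≤ (Σᵢ|Pᵢ|)²·(81Λ⁴Ψ₀ + 11Λ²Ψ₂ + Ψ₄ + Ψ_B)`.
[cite: KowalskiMichelVanderKam2000, (23)–(28) — derivation (order-(1,3) remainder weight, general profile)] -/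
theorem abs_profile_weight_le₁₃ (P : ℝ[X]) (hP0 : P.coeff 0 = 0) {a P2 P4 : ℕ → ℝ}
    {R₀₀ R₀₁ R₁₀ R₀₂ R₁₁ R₁₂ R₀₃ R₁₃ : ℝ → ℝ} {Y α β Λ Ψ₀ Ψ₂ Ψ₄ ΨB L : ℝ}
    (hY : 1 ≤ Y) (hΛ : 1 ≤ Λ) (hβ : |β| ≤ Λ) (hLY : Real.log Y ≤ Λ)
    (hΨ₀ : 0 ≤ Ψ₀) (hΨ₂ : 0 ≤ Ψ₂) (hΨ₄ : 0 ≤ Ψ₄) (hΨB : 0 ≤ ΨB) (hL : 0 < L) (hYL : Real.log Y ≤ L)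
    (h0 : ∀ R : ℝ → ℝ, (R = R₀₀ ∨ R = R₀₁ ∨ R = R₁₀ ∨ R = R₀₂ ∨ R = R₁₁ ∨ R = R₁₂ ∨ R = R₀₃ ∨ R = R₁₃) →
      ∀ i j : ℕ, 1 ≤ i → 1 ≤ j →
      |∑ k₁ ∈ Icc 1 ⌊Y⌋₊, ∑ k₂ ∈ Icc 1 ⌊Y⌋₊,
          a k₁ * a k₂ * ellp Y k₁ ^ i * ellp Y k₂ ^ j * R (α * k₁ * k₂)| ≤ Real.log Y ^ (i + j) * Ψ₀)
    (h2 : ∀ R : ℝ → ℝ, (R = R₀₁ ∨ R = R₁₀ ∨ R = R₀₂ ∨ R = R₁₁) →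
      ∀ i j : ℕ, 1 ≤ i → 1 ≤ j →
      |∑ k₁ ∈ Icc 1 ⌊Y⌋₊, ∑ k₂ ∈ Icc 1 ⌊Y⌋₊,
          a k₁ * (a k₂ * P2 k₂) * ellp Y k₁ ^ i * ellp Y k₂ ^ j * R (α * k₁ * k₂)| ≤ Real.log Y ^ (i + j) * Ψ₂)
    (h4 : ∀ i j : ℕ, 1 ≤ i → 1 ≤ j →
      |∑ k₁ ∈ Icc 1 ⌊Y⌋₊, ∑ k₂ ∈ Icc 1 ⌊Y⌋₊,
          a k₁ * (a k₂ * (3 * P2 k₂ ^ 2 - 2 * P4 k₂)) * ellp Y k₁ ^ i * ellp Y k₂ ^ j * R₀₀ (α * k₁ * k₂)| ≤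
        Real.log Y ^ (i + j) * Ψ₄)
    (hB : ∀ i j : ℕ, 1 ≤ i → 1 ≤ j →
      |∑ k₁ ∈ Icc 1 ⌊Y⌋₊, ∑ k₂ ∈ Icc 1 ⌊Y⌋₊,
          (a k₁ * P2 k₁) * (a k₂ * P2 k₂) * ellp Y k₁ ^ i * ellp Y k₂ ^ j * R₀₀ (α * k₁ * k₂)| ≤
        Real.log Y ^ (i + j) * ΨB) :
    |∑ k₁ ∈ Icc 1 ⌊Y⌋₊, ∑ k₂ ∈ Icc 1 ⌊Y⌋₊,
        a k₁ * P.eval (ellp Y k₁ / L) * (a k₂ * P.eval (ellp Y k₂ / L)) *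
          ((((2 * β + ellp Y k₁ + ellp Y k₂) ^ 4 - 3 * (P2 k₁ + P2 k₂) ^ 2 + 2 * (P4 k₁ + P4 k₂)) / 16 * R₀₀ (α * k₁ * k₂) +
            (3 * (2 * β + ellp Y k₁ + ellp Y k₂) ^ 3 - 3 * (2 * β + ellp Y k₁ + ellp Y k₂) * (P2 k₁ + P2 k₂)) / 8 * R₀₁ (α * k₁ * k₂) +
            (3 * (2 * β + ellp Y k₁ + ellp Y k₂) ^ 2 - 3 * (P2 k₁ + P2 k₂)) / 4 * R₀₂ (α * k₁ * k₂) +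
            (2 * β + ellp Y k₁ + ellp Y k₂) / 2 * R₀₃ (α * k₁ * k₂) +
            ((2 * β + ellp Y k₁ + ellp Y k₂) ^ 3 + 3 * (2 * β + ellp Y k₁ + ellp Y k₂) * (P2 k₁ + P2 k₂)) / 8 * R₁₀ (α * k₁ * k₂) +
            (3 * (2 * β + ellp Y k₁ + ellp Y k₂) ^ 2 + 3 * (P2 k₁ + P2 k₂)) / 4 * R₁₁ (α * k₁ * k₂) +
            3 * (2 * β + ellp Y k₁ + ellp Y k₂) / 2 * R₁₂ (α * k₁ * k₂) +
            R₁₃ (α * k₁ * k₂)))| ≤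
      (∑ i ∈ Finset.range (P.natDegree + 1), |P.coeff i|) ^ 2 * (81 * Λ ^ 4 * Ψ₀ + 11 * Λ ^ 2 * Ψ₂ + Ψ₄ + ΨB) := by
  have hL0 : 0 ≤ Real.log Y := Real.log_nonneg hY
  set Rg := Finset.range (P.natDegree + 1) with hRg
  set SP : ℝ := ∑ i ∈ Rg, |P.coeff i| with hSP
  have hratio : Real.log Y / L ≤ 1 := (div_le_one hL).2 hYL
  have hratio0 : 0 ≤ Real.log Y / L := div_nonneg hL0 hL.le
  rw [profile_expand P L Y a a (fun k₁ k₂ ↦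
      ((((2 * β + ellp Y k₁ + ellp Y k₂) ^ 4 - 3 * (P2 k₁ + P2 k₂) ^ 2 + 2 * (P4 k₁ + P4 k₂)) / 16 * R₀₀ (α * k₁ * k₂) +
            (3 * (2 * β + ellp Y k₁ + ellp Y k₂) ^ 3 - 3 * (2 * β + ellp Y k₁ + ellp Y k₂) * (P2 k₁ + P2 k₂)) / 8 * R₀₁ (α * k₁ * k₂) +
            (3 * (2 * β + ellp Y k₁ + ellp Y k₂) ^ 2 - 3 * (P2 k₁ + P2 k₂)) / 4 * R₀₂ (α * k₁ * k₂) +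
            (2 * β + ellp Y k₁ + ellp Y k₂) / 2 * R₀₃ (α * k₁ * k₂) +
            ((2 * β + ellp Y k₁ + ellp Y k₂) ^ 3 + 3 * (2 * β + ellp Y k₁ + ellp Y k₂) * (P2 k₁ + P2 k₂)) / 8 * R₁₀ (α * k₁ * k₂) +
            (3 * (2 * β + ellp Y k₁ + ellp Y k₂) ^ 2 + 3 * (P2 k₁ + P2 k₂)) / 4 * R₁₁ (α * k₁ * k₂) +
            3 * (2 * β + ellp Y k₁ + ellp Y k₂) / 2 * R₁₂ (α * k₁ * k₂) +
            R₁₃ (α * k₁ * k₂))))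
    (Icc 1 ⌊Y⌋₊)]
  set G : ℝ := 81 * Λ ^ 4 * Ψ₀ + 11 * Λ ^ 2 * Ψ₂ + Ψ₄ + ΨB with hG
  have hG0 : 0 ≤ G := by positivity
  have hterm : ∀ i ∈ Rg, ∀ j ∈ Rg, |P.coeff i / L ^ i * (P.coeff j / L ^ j) *
      ∑ k₁ ∈ Icc 1 ⌊Y⌋₊, ∑ k₂ ∈ Icc 1 ⌊Y⌋₊, a k₁ * a k₂ * ellp Y k₁ ^ i * ellp Y k₂ ^ j *
        ((((2 * β + ellp Y k₁ + ellp Y k₂) ^ 4 - 3 * (P2 k₁ + P2 k₂) ^ 2 + 2 * (P4 k₁ + P4 k₂)) / 16 * R₀₀ (α * k₁ * k₂) +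
            (3 * (2 * β + ellp Y k₁ + ellp Y k₂) ^ 3 - 3 * (2 * β + ellp Y k₁ + ellp Y k₂) * (P2 k₁ + P2 k₂)) / 8 * R₀₁ (α * k₁ * k₂) +
            (3 * (2 * β + ellp Y k₁ + ellp Y k₂) ^ 2 - 3 * (P2 k₁ + P2 k₂)) / 4 * R₀₂ (α * k₁ * k₂) +
            (2 * β + ellp Y k₁ + ellp Y k₂) / 2 * R₀₃ (α * k₁ * k₂) +
            ((2 * β + ellp Y k₁ + ellp Y k₂) ^ 3 + 3 * (2 * β + ellp Y k₁ + ellp Y k₂) * (P2 k₁ + P2 k₂)) / 8 * R₁₀ (α * k₁ * k₂) +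
            (3 * (2 * β + ellp Y k₁ + ellp Y k₂) ^ 2 + 3 * (P2 k₁ + P2 k₂)) / 4 * R₁₁ (α * k₁ * k₂) +
            3 * (2 * β + ellp Y k₁ + ellp Y k₂) / 2 * R₁₂ (α * k₁ * k₂) +
            R₁₃ (α * k₁ * k₂)))| ≤
      |P.coeff i| * |P.coeff j| * G := by
    intro i _ j _
    rcases Nat.eq_zero_or_pos i with rfl | hi
    · rw [hP0]; simp
    rcases Nat.eq_zero_or_pos j with rfl | hj
    · rw [hP0]; simp
    rw [abs_mul, abs_mul, abs_div, abs_div, abs_of_pos (pow_pos hL i), abs_of_pos (pow_pos hL j)]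
    have h := abs_monomial_weight_le₁₃ (m₁ := i) (m₂ := j) hi hj hY hΛ hβ hLY hΨ₀ hΨ₂ hΨ₄ hΨB h0 h2 h4 hB
    have hpow : Real.log Y ^ (i + j) / (L ^ i * L ^ j) ≤ 1 := by
      rw [← pow_add, ← div_pow]
      exact pow_le_one₀ hratio0 hratio
    calc |P.coeff i| / L ^ i * (|P.coeff j| / L ^ j) *
          |∑ k₁ ∈ Icc 1 ⌊Y⌋₊, ∑ k₂ ∈ Icc 1 ⌊Y⌋₊, a k₁ * a k₂ * ellp Y k₁ ^ i * ellp Y k₂ ^ j *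
            ((((2 * β + ellp Y k₁ + ellp Y k₂) ^ 4 - 3 * (P2 k₁ + P2 k₂) ^ 2 + 2 * (P4 k₁ + P4 k₂)) / 16 * R₀₀ (α * k₁ * k₂) +
            (3 * (2 * β + ellp Y k₁ + ellp Y k₂) ^ 3 - 3 * (2 * β + ellp Y k₁ + ellp Y k₂) * (P2 k₁ + P2 k₂)) / 8 * R₀₁ (α * k₁ * k₂) +
            (3 * (2 * β + ellp Y k₁ + ellp Y k₂) ^ 2 - 3 * (P2 k₁ + P2 k₂)) / 4 * R₀₂ (α * k₁ * k₂) +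
            (2 * β + ellp Y k₁ + ellp Y k₂) / 2 * R₀₃ (α * k₁ * k₂) +
            ((2 * β + ellp Y k₁ + ellp Y k₂) ^ 3 + 3 * (2 * β + ellp Y k₁ + ellp Y k₂) * (P2 k₁ + P2 k₂)) / 8 * R₁₀ (α * k₁ * k₂) +
            (3 * (2 * β + ellp Y k₁ + ellp Y k₂) ^ 2 + 3 * (P2 k₁ + P2 k₂)) / 4 * R₁₁ (α * k₁ * k₂) +
            3 * (2 * β + ellp Y k₁ + ellp Y k₂) / 2 * R₁₂ (α * k₁ * k₂) +
            R₁₃ (α * k₁ * k₂)))|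
        ≤ |P.coeff i| / L ^ i * (|P.coeff j| / L ^ j) * (G * Real.log Y ^ (i + j)) :=
          mul_le_mul_of_nonneg_left h (by positivity)
      _ = |P.coeff i| * |P.coeff j| * G * (Real.log Y ^ (i + j) / (L ^ i * L ^ j)) := by
          field_simp
      _ ≤ |P.coeff i| * |P.coeff j| * G * 1 := by gcongr
      _ = _ := mul_one _
  calc _ ≤ ∑ i ∈ Rg, ∑ j ∈ Rg, |P.coeff i| * |P.coeff j| * G := by
        refine (Finset.abs_sum_le_sum_abs _ _).trans (Finset.sum_le_sum fun i hi ↦ ?_)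
        exact (Finset.abs_sum_le_sum_abs _ _).trans (Finset.sum_le_sum fun j hj ↦ hterm i hi j hj)
    _ = SP * SP * G := by
        rw [hSP, Finset.sum_mul_sum, Finset.sum_mul]
        refine Finset.sum_congr rfl fun i _ ↦ ?_
        rw [Finset.sum_mul]
    _ = SP ^ 2 * G := by ring

end Summit.Parity.GeneralizedHardyLittlewood.Theorems.MomentsBeyondDiagonal.DiagCorner

end
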